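import Summits.QuantumFields.YangMills.Theorems.CovariantDischargeHaarSweepReweighting
import HarnessLib

/-!
# Line «sandwich_discharge» on crux `HistoryTailL` (stmt-QuantumFields-19936), stub `stub_sandwichSweepGapCapped` — brick B2′:
# a sweep whose direction fields read only links OFF the swept set IS the simultaneous left product, `dU`-preserving, with explicit inverse

Cell `ym3-torus` (YM ladder rung R3 = continuum SU(2) Yang–Mills on the three-torus — a RUNG, NOT the Clay problem), width seat `ym3-torus-px8`
gen 6, `--supports` only (helper; ★★OWNER RULING №25 (b): text-independent letter typed HOME, filed on the LEAD's word; ARCH-SPRIME-px8g6 §2).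
✓`CovariantDischargeHaarSweepReweighting` §1–§2 gives: a single-link skew left translation `U ↦ update U b (n(U)·U_b)` whose direction field `n`
does not read the link `b` preserves `dU`, and finite compositions (`foldr`) of such maps preserve `dU`.  A composed sweep, however, evaluates the
LATER direction fields on the PARTIALLY SWEPT field — not on the original `V` — which is what the first-order bookkeeping of a covariant
Cameron–Martin sweep (frames `X_b(V)`) wants to avoid.  THIS FILE isolates the condition under which the two coincide and packages the result
in the shape the sweep-gap stub consumes (`∃ Ψ Ψ′, MeasurePreserving Ψ ∧ Measurable Ψ′ ∧ LeftInverse Ψ′ Ψ ∧ RightInverse Ψ′ Ψ`):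
if NO direction field reads ANY link of the swept set `S` (e.g. frames transported along a spanning tree, amplitude supported off the tree —
the gauge freedom `a ↦ a + dλ` makes any amplitude tree-free without changing `da`), then
* `agree_off_imp_dir_eq` — direction fields take the same value on fields that agree off `S`;
* ★ `foldr_sweep_eq_simultaneous` — the composed sweep over a duplicate-free list `l ⊆ S` IS the simultaneous product
  `U ↦ (b ↦ if b ∈ l then n_b(U)·U_b else U_b)`;
* ★ `measurePreserving_simultaneous` / `measurable_simultaneous_inv` / `leftInverse_simultaneous` / `rightInverse_simultaneous` — the
  simultaneous product preserves `dU` and is inverted by the simultaneous product with the inverse directions (read on the SAME field);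
* ★★ `exists_sweep_pair` — the packaged `∃ Ψ Ψ′` with `Ψ′ U = (b ↦ if b ∈ S then n_b(U)⁻¹·U_b else U_b)` in the stub's four-clause shape.
WHAT THIS IS NOT: no frames, no profile, no action estimate; nothing of the capped stub, `HistoryTailL`, the rung R3, d = 4 or a mass gap is proved.
YM₃ on T³ is rung R3, NOT Clay.  References: T. Bałaban, CMP **98** (1985) 17–51 [Balaban1985Averaging] ((10) p.19, the product Haar measure).  [folklore]
-/

noncomputable section

open MeasureTheory

namespace Summit.QuantumFields.YangMills.Theorems.CovariantDischargeSweepSimultaneous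

open Literature.MathematicalPhysics.QuantumFieldTheory.Balaban1983to89
open Summit.QuantumFields.YangMills.Theorems.CovariantDischargeHaarSweepReweighting
  (measurePreserving_update_mul_left measurePreserving_foldr_comp)

variable {P : Params} {j : ℕ} {G : Type*} [GaugeGroup G] [DecidableEq (PBond P j)]

omit [GaugeGroup G] in
/-- Direction fields that do not read the links of `S` take the same value on two fields agreeing OFF `S`. [folklore] -/
theorem agree_off_imp_dir_eq {S : Finset (PBond P j)} {m : GaugeField P j G → G}
    (hread : ∀ (U : GaugeField P j G) (b' : PBond P j) (g : G), b' ∈ S → m (Function.update U b' g) = m U) :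
    ∀ (D : Finset (PBond P j)), D ⊆ S → ∀ (U U' : GaugeField P j G), (∀ b, b ∉ D → U' b = U b) → m U' = m U := by
  intro D
  induction D using Finset.induction with
  | empty =>
    intro _ U U' h
    have : U' = U := funext fun b => h b (Finset.notMem_empty b)
    rw [this]
  | @insert b₀ D hb₀ ih =>
    intro hDS U U' hagree
    have hb₀S : b₀ ∈ S := hDS (Finset.mem_insert_self b₀ D)
    -- repair the link `b₀` first
    set U'' : GaugeField P j G := Function.update U' b₀ (U b₀) with hU''
    have h1 : m U'' = m U := by
      refine ih (fun b hb => hDS (Finset.mem_insert_of_mem hb)) U U'' fun b hb => ?_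
      by_cases hbb : b = b₀
      · subst hbb; simp [hU'']
      · rw [hU'', Function.update_of_ne hbb]
        exact hagree b (by simp [hbb, hb])
    have h2 : U' = Function.update U'' b₀ (U' b₀) := by
      funext b
      by_cases hbb : b = b₀
      · subst hbb; simp
      · rw [Function.update_of_ne hbb, hU'', Function.update_of_ne hbb]
    rw [h2, hread U'' b₀ (U' b₀) hb₀S, h1]

variable (n : PBond P j → GaugeField P j G → G)

/-- ★ **A SWEEP WHOSE DIRECTIONS READ ONLY LINKS OFF THE SWEPT SET IS THE SIMULTANEOUS LEFT PRODUCT.**  For a duplicate-free list `l` of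
links of `S` and direction fields `n_b` none of which reads a link of `S`, the composition (`foldr`) of the single-link skew translations
`U ↦ update U b (n_b(U)·U_b)`, `b ∈ l`, equals `U ↦ (b ↦ if b ∈ l then n_b(U)·U_b else U_b)`. [folklore] -/
theorem foldr_sweep_eq_simultaneous {S : Finset (PBond P j)}
    (hread : ∀ (b : PBond P j) (U : GaugeField P j G) (b' : PBond P j) (g : G), b' ∈ S → n b (Function.update U b' g) = n b U) :
    ∀ (l : List (PBond P j)), l.Nodup → (∀ b ∈ l, b ∈ S) →
      (l.map fun b => fun U : GaugeField P j G => Function.update U b (n b U * U b)).foldr (· ∘ ·) id =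
        fun U b => if b ∈ l then n b U * U b else U b
  | [], _, _ => by
    funext U b
    rw [if_neg (List.not_mem_nil)]
    rfl
  | b₀ :: l, hnd, hlS => by
    have hnd' : l.Nodup := (List.nodup_cons.mp hnd).2
    have hb₀l : b₀ ∉ l := (List.nodup_cons.mp hnd).1
    have hlS' : ∀ b ∈ l, b ∈ S := fun b hb => hlS b (List.mem_cons_of_mem b₀ hb)
    have IH := foldr_sweep_eq_simultaneous hread l hnd' hlS'
    show ((fun U : GaugeField P j G => Function.update U b₀ (n b₀ U * U b₀)) ∘
        (l.map fun b => fun U : GaugeField P j G => Function.update U b (n b U * U b)).foldr (· ∘ ·) id) = _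
    rw [IH]
    funext U b
    simp only [Function.comp_apply]
    -- the direction at `b₀` read on the partially swept field equals the direction read on `U`
    have hdir : n b₀ (fun b => if b ∈ l then n b U * U b else U b) = n b₀ U :=
      agree_off_imp_dir_eq (m := n b₀) (fun U b' g hb' => hread b₀ U b' g hb') l.toFinset
        (fun b hb => hlS' b (List.mem_toFinset.mp hb)) U _ fun b hb => by
          rw [List.mem_toFinset] at hb; simp [hb]
    by_cases hb : b = b₀
    · subst hb
      simp [hb₀l, hdir]
    · rw [Function.update_of_ne hb]
      by_cases hbl : b ∈ l
      · simp [hbl, List.mem_cons, hb]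
      · simp [hbl, List.mem_cons, hb]

variable [MeasurableSpace G] [HaarData G] [MeasurableMul₂ G]

/-- ★ **THE SIMULTANEOUS PRODUCT PRESERVES `dU`** (it is a sweep of admissible single-link translations). [cite: Balaban1985Averaging, (10) p.19] -/
theorem measurePreserving_simultaneous {S : Finset (PBond P j)} (hn : ∀ b, Measurable (n b))
    (hread : ∀ (b : PBond P j) (U : GaugeField P j G) (b' : PBond P j) (g : G), b' ∈ S → n b (Function.update U b' g) = n b U)
    (l : List (PBond P j)) (hnd : l.Nodup) (hlS : ∀ b ∈ l, b ∈ S) :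
    MeasurePreserving (fun (U : GaugeField P j G) (b : PBond P j) => if b ∈ l then n b U * U b else U b)
      (fieldMeasure P j G) (fieldMeasure P j G) := by
  rw [← foldr_sweep_eq_simultaneous n hread l hnd hlS]
  refine measurePreserving_foldr_comp _ fun Ψ hΨ => ?_
  obtain ⟨b, hb, rfl⟩ := List.mem_map.mp hΨ
  exact measurePreserving_update_mul_left b (hn b) fun U g => hread b U b g (hlS b hb)

variable [MeasurableInv G]

omit [HaarData G] in
/-- The simultaneous product with the INVERSE directions is measurable. [folklore] -/
theorem measurable_simultaneous_inv (hn : ∀ b, Measurable (n b)) (l : List (PBond P j)) :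
    Measurable (fun (U : GaugeField P j G) (b : PBond P j) => if b ∈ l then (n b U)⁻¹ * U b else U b) := by
  refine measurable_pi_lambda _ fun b => ?_
  by_cases hb : b ∈ l
  · simp only [hb, if_true]
    exact ((hn b).inv).mul (measurable_pi_apply b)
  · simp only [hb, if_false]
    exact measurable_pi_apply b

omit [MeasurableSpace G] [HaarData G] [MeasurableMul₂ G] [MeasurableInv G] in
/-- The inverse-direction product undoes the simultaneous product (directions read on the swept field equal directions read on the original,
because the two fields agree off `S`). [folklore] -/
theorem leftInverse_simultaneous {S : Finset (PBond P j)}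
    (hread : ∀ (b : PBond P j) (U : GaugeField P j G) (b' : PBond P j) (g : G), b' ∈ S → n b (Function.update U b' g) = n b U)
    (l : List (PBond P j)) (hlS : ∀ b ∈ l, b ∈ S) :
    Function.LeftInverse (fun (U : GaugeField P j G) (b : PBond P j) => if b ∈ l then (n b U)⁻¹ * U b else U b)
      (fun (U : GaugeField P j G) (b : PBond P j) => if b ∈ l then n b U * U b else U b) := by
  intro U
  funext b
  have hdir : ∀ b₀, n b₀ (fun b => if b ∈ l then n b U * U b else U b) = n b₀ U := fun b₀ =>
    agree_off_imp_dir_eq (m := n b₀) (fun U b' g hb' => hread b₀ U b' g hb') l.toFinset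
      (fun b hb => hlS b (List.mem_toFinset.mp hb)) U _ fun b hb => by
        rw [List.mem_toFinset] at hb; simp [hb]
  by_cases hb : b ∈ l
  · simp [hb, hdir b]
  · simp [hb]

omit [MeasurableSpace G] [HaarData G] [MeasurableMul₂ G] [MeasurableInv G] in
/-- … and the simultaneous product undoes the inverse-direction product. [folklore] -/
theorem rightInverse_simultaneous {S : Finset (PBond P j)}
    (hread : ∀ (b : PBond P j) (U : GaugeField P j G) (b' : PBond P j) (g : G), b' ∈ S → n b (Function.update U b' g) = n b U)
    (l : List (PBond P j)) (hlS : ∀ b ∈ l, b ∈ S) :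
    Function.RightInverse (fun (U : GaugeField P j G) (b : PBond P j) => if b ∈ l then (n b U)⁻¹ * U b else U b)
      (fun (U : GaugeField P j G) (b : PBond P j) => if b ∈ l then n b U * U b else U b) := by
  intro U
  funext b
  have hread' : ∀ (b : PBond P j) (U : GaugeField P j G) (b' : PBond P j) (g : G), b' ∈ S →
      (fun V => (n b V)⁻¹) (Function.update U b' g) = (fun V => (n b V)⁻¹) U :=
    fun b U b' g hb' => congrArg (fun x : G => x⁻¹) (hread b U b' g hb')
  have hdir : ∀ b₀, n b₀ (fun b => if b ∈ l then (n b U)⁻¹ * U b else U b) = n b₀ U := fun b₀ => by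
    have := agree_off_imp_dir_eq (m := n b₀) (fun U b' g hb' => hread b₀ U b' g hb') l.toFinset
      (fun b hb => hlS b (List.mem_toFinset.mp hb)) U (fun b => if b ∈ l then (n b U)⁻¹ * U b else U b) fun b hb => by
        rw [List.mem_toFinset] at hb; simp [hb]
    exact this
  by_cases hb : b ∈ l
  · simp [hb, hdir b]
  · simp [hb]

/-- ★★ **THE PACKAGED SWEEP PAIR** in the four-clause shape of the sweep-gap stubs: for direction fields `n_b` (measurable, none reading a link
of `S`), `Ψ U := (b ↦ if b ∈ S then n_b(U)·U_b else U_b)` is `dU`-preserving, and `Ψ′ U := (b ↦ if b ∈ S then n_b(U)⁻¹·U_b else U_b)` is its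
measurable two-sided inverse. [cite: Balaban1985Averaging, (10) p.19] -/
theorem exists_sweep_pair (S : Finset (PBond P j)) (hn : ∀ b, Measurable (n b))
    (hread : ∀ (b : PBond P j) (U : GaugeField P j G) (b' : PBond P j) (g : G), b' ∈ S → n b (Function.update U b' g) = n b U) :
    ∃ Ψ Ψ' : GaugeField P j G → GaugeField P j G,
      MeasurePreserving Ψ (fieldMeasure P j G) (fieldMeasure P j G) ∧ Measurable Ψ' ∧
        Function.LeftInverse Ψ' Ψ ∧ Function.RightInverse Ψ' Ψ ∧
        (∀ U b, Ψ U b = if b ∈ S then n b U * U b else U b) ∧ (∀ U b, Ψ' U b = if b ∈ S then (n b U)⁻¹ * U b else U b) := by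
  have hmem : ∀ b, b ∈ S.toList ↔ b ∈ S := fun b => Finset.mem_toList
  refine ⟨fun U b => if b ∈ S.toList then n b U * U b else U b, fun U b => if b ∈ S.toList then (n b U)⁻¹ * U b else U b,
    measurePreserving_simultaneous n hn hread S.toList (Finset.nodup_toList S) (fun b hb => (hmem b).mp hb),
    measurable_simultaneous_inv n hn S.toList,
    leftInverse_simultaneous n hread S.toList (fun b hb => (hmem b).mp hb),
    rightInverse_simultaneous n hread S.toList (fun b hb => (hmem b).mp hb), fun U b => ?_, fun U b => ?_⟩
  · simp only [hmem]
  · simp only [hmem]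

end Summit.QuantumFields.YangMills.Theorems.CovariantDischargeSweepSimultaneous

end
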